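import Summits.RiemannHypothesis.RiemannHypothesis.Theorems.TiltedLandingLaw421R3LandingDoor

/-!
# lens-1 (rh33346) — TWO-BODY U: the pinned upper cluster door with `S = {v, c}` (MIDPOINT-centred, free field constant `K`)

Candidate owner of cell «COV» (stacked / roofing pairs; KIT-1 S-COV) and of the close-partner part of cell «E».  Ideation workfile
(helper currency: the conclusion is the Q8 door U of record `RhW08.AntiEscapeSplit7.ClusterNumbersU`).  Nothing here bears on the truth
of RH; RH is not proved; 33346/33347 OPEN.

`clusterNumbersU_of_isolatedPair`: two distinct SIMPLE upper zeros `v, c` of `F := f^{(j)}`; centre `c₀ := (v + c)/2`, half-separation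
`d := (v − c)/2`; a radius `ρ` with `‖d‖ < ρ ≤ Im c₀` (both bodies strictly inside, disc in the upper half-plane — possible iff
`|Re v − Re c|² < 4·Im v·Im c`), column `|Re c₀ − x₀| + ρ ≤ R/2`, ISOLATION of the pair (`ρ < ‖z − c₀‖` for every other zero `z` of `F`),
a FREE constant `K` (the external field at the pair; best `K ≈ (h′/h)(c₀)`), and the POINTWISE Rouché clause on the circle `‖z − c₀‖ = ρ`:
`‖(z − v)(z − c)‖·‖(h′/h)(z) − K‖ < ‖(z − v) + (z − c) + K·(z − v)(z − c)‖`, `h := dslope (dslope F v) c` the pair cofactor.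
Then door U holds with `S = {v, c}`, `m ≡ 1`, model `M = 2(z − c₀) + K((z − c₀)² − d²)`.  The model zero inside the disc is FREE OF CHARGE:
in `w = z − c₀` the model is `K w² + 2 w − K d²`, whose two roots have product `−d²` (Vieta), so one root has `‖w‖ ≤ ‖d‖ < ρ`
(`K = 0`: `w = 0`).  No strength hypothesis on `K` is needed.  Frame corollary `succ_of_isolatedPair` := `succ_of_clusterNumbersU`.
-/

set_option linter.unusedVariables false
set_option linter.unusedSectionVars false

namespace RhW08.Lens1TwoBody

noncomputable section

open Complex Set Filter Metric Topology
open scoped ComplexConjugate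
open Literature.Analysis.Complex
open RhIdea6.G17.W07C7 RhIdea6.G17.W07C7.Rev6 RhIdea6.G18.W07C8.Law421BirthS RhIdea6.G19.W07C11.Seam
open RhIdea6.G20.W07C12.Frac RhIdea6.G20.W07C12.StColP RhW07.C12.FieldSplit RhIdea6.G21.W07C13.TentMax
open RhW07.C14.TwoSided RhW07.C14.Classes RhW07.C14.Lineage RhW07.C14.Booking
open RhW07.C13.Heredity RhIdea6.G22.W07C15pre.Injection RhW07.E3.Cell RhW07.E3.Lit
open RhW08.Round1 RhW08.StSwap RhW08.Round2 RhW08.QuadW RhW08.SealSwapQ RhW08.SealSwap RhW08.SuccB RhW08.SuccSplit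
open RhW08.ClusterQ RhW08.ClusterQM RhW08.AntiEscapeSplit7

/-- The near polynomial of the two-body cluster `S = {v, c}`, `m ≡ 1`, is `(z − v)(z − c)`. -/
theorem nearPoly_pair_eval {v c : ℂ} (hvc : v ≠ c) (z : ℂ) : (nearPoly {v, c} (fun _ => 1)).eval z = (z - v) * (z - c) := by
  simp [nearPoly, Finset.prod_pair hvc]

/-- The two-body pinned model is `M = (z − v) + (z − c) + K·(z − v)(z − c)`. -/
theorem tiltModel_pair_eval {v c : ℂ} (hvc : v ≠ c) (K z : ℂ) :
    (tiltModel {v, c} (fun _ => 1) K).eval z = (z - v) + (z - c) + K * ((z - v) * (z - c)) := by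
  simp [tiltModel, nearPoly, Finset.prod_pair hvc]; ring

/-- VIETA FOR THE MODEL: in the coordinate `w = z − c₀` the two-body model `2w + K(w² − d²)` has a zero with `‖w‖ < ρ` as soon as
`‖d‖ < ρ` (the two roots have product `−d²`; `K = 0`: `w = 0`). -/
theorem exists_model_root (K d : ℂ) {ρ : ℝ} (hdρ : ‖d‖ < ρ) : ∃ w : ℂ, ‖w‖ < ρ ∧ 2 * w + K * (w * w - d * d) = 0 := by
  have hρ0 : 0 < ρ := lt_of_le_of_lt (norm_nonneg d) hdρ
  by_cases hK0 : K = 0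
  · exact ⟨0, by simpa using hρ0, by rw [hK0]; ring⟩
  obtain ⟨s, hs⟩ := IsAlgClosed.exists_eq_mul_self (discrim K 2 (-(K * (d * d))))
  have hr : ∀ w : ℂ, w = (-2 + s) / (2 * K) ∨ w = (-2 - s) / (2 * K) → 2 * w + K * (w * w - d * d) = 0 := by
    intro w hw
    have e := (quadratic_eq_zero_iff hK0 hs w).2 hw
    linear_combination e
  have hs' : s * s = 4 + 4 * (K * K) * (d * d) := by rw [← hs, discrim]; ring
  have hprod : ((-2 + s) / (2 * K)) * ((-2 - s) / (2 * K)) = -(d * d) := by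
    field_simp
    linear_combination (-1 : ℂ) * hs'
  have hnorm : ‖(-2 + s) / (2 * K)‖ * ‖(-2 - s) / (2 * K)‖ = ‖d‖ * ‖d‖ := by
    rw [← norm_mul, hprod, norm_neg, norm_mul]
  by_cases h1 : ‖(-2 + s) / (2 * K)‖ < ρ
  · exact ⟨_, h1, hr _ (Or.inl rfl)⟩
  · refine ⟨_, ?_, hr _ (Or.inr rfl)⟩
    push Not at h1
    by_contra h2
    push Not at h2
    have : ρ * ρ ≤ ‖(-2 + s) / (2 * K)‖ * ‖(-2 - s) / (2 * K)‖ := mul_le_mul h1 h2 hρ0.le (norm_nonneg _)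
    rw [hnorm] at this
    nlinarith [norm_nonneg d]

/-- **TWO-BODY U FROM PAIR ISOLATION.**  See the module docstring. -/
theorem clusterNumbersU_of_isolatedPair {f : ℂ → ℂ} (hf : Differentiable ℂ f) {x₀ R : ℝ} {j : ℕ} {v c : ℂ} (hvc : v ≠ c)
    (hv : iteratedDeriv j f v = 0) (hc : iteratedDeriv j f c = 0)
    (hv1 : iteratedDeriv (j + 1) f v ≠ 0) (hc1 : iteratedDeriv (j + 1) f c ≠ 0)
    {ρ : ℝ} (hρd : ‖(v - c) / 2‖ < ρ) (hρim : ρ ≤ ((v + c) / 2).im) (hcol : |((v + c) / 2).re - x₀| + ρ ≤ R / 2)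
    (hiso : ∀ z : ℂ, iteratedDeriv j f z = 0 → z ≠ v → z ≠ c → ρ < ‖z - (v + c) / 2‖)
    (K : ℂ)
    (hvar : ∀ z : ℂ, ‖z - (v + c) / 2‖ = ρ →
      ‖(z - v) * (z - c)‖ *
          ‖deriv (dslope (dslope (iteratedDeriv j f) v) c) z / dslope (dslope (iteratedDeriv j f) v) c z - K‖ <
        ‖(z - v) + (z - c) + K * ((z - v) * (z - c))‖) :
    ClusterNumbersU f x₀ R j := by
  set F : ℂ → ℂ := iteratedDeriv j f with hF_def
  set F₁ : ℂ → ℂ := dslope F v with hF₁_def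
  set h : ℂ → ℂ := dslope F₁ c with hh_def
  set c₀ : ℂ := (v + c) / 2 with hc₀
  set d : ℂ := (v - c) / 2 with hd
  have hρ0 : 0 < ρ := lt_of_le_of_lt (norm_nonneg _) hρd
  have hFd : Differentiable ℂ F := differentiable_iteratedDeriv_of_entire hf j
  have hF₁d : Differentiable ℂ F₁ :=
    differentiableOn_univ.1 ((Complex.differentiableOn_dslope (univ_mem : (univ : Set ℂ) ∈ 𝓝 v)).2 hFd.differentiableOn)
  have hhd : Differentiable ℂ h :=
    differentiableOn_univ.1 ((Complex.differentiableOn_dslope (univ_mem : (univ : Set ℂ) ∈ 𝓝 c)).2 hF₁d.differentiableOn)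
  have hfac1 : ∀ z, F z = (z - v) * F₁ z := by
    intro z
    have e := sub_smul_dslope F v z
    rw [smul_eq_mul, hv, sub_zero] at e
    exact e.symm
  have hcv : c - v ≠ 0 := sub_ne_zero.2 hvc.symm
  have hF₁c : F₁ c = 0 := by
    have e := hfac1 c
    rw [hc] at e
    exact (mul_eq_zero.1 e.symm).resolve_left hcv
  have hfac2 : ∀ z, F₁ z = (z - c) * h z := by
    intro z
    have e := sub_smul_dslope F₁ c z
    rw [smul_eq_mul, hF₁c, sub_zero] at e
    exact e.symm
  have hfac : ∀ z, F z = ((z - v) * (z - c)) * h z := by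
    intro z; rw [hfac1 z, hfac2 z]; ring
  -- the cofactor does not vanish at the two bodies (simplicity)
  have hF₁v : F₁ v = iteratedDeriv (j + 1) f v := by
    rw [hF₁_def, dslope_same, hF_def, ← iteratedDeriv_succ]
  have hhv : h v ≠ 0 := by
    intro h0
    have e := hfac2 v
    rw [h0, mul_zero, hF₁v] at e
    exact hv1 e
  have hdc : deriv F c = (c - v) * deriv F₁ c := by
    have h1 : HasDerivAt (fun z => (z - v) * F₁ z) (1 * F₁ c + (c - v) * deriv F₁ c) c :=
      ((hasDerivAt_id c).sub_const v).mul (hF₁d c).hasDerivAt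
    rw [hF₁c, mul_zero, zero_add] at h1
    have hFeq : F = fun z => (z - v) * F₁ z := funext hfac1
    rw [hFeq]; exact h1.deriv
  have hhc : h c ≠ 0 := by
    intro h0
    have e1 : h c = deriv F₁ c := by rw [hh_def, dslope_same]
    have e2 : deriv F c = iteratedDeriv (j + 1) f c := by rw [hF_def, ← iteratedDeriv_succ]
    apply hc1
    rw [← e2, hdc, ← e1, h0, mul_zero]
  -- `h` is zero-free on the closed disc
  have hh0 : ∀ z : ℂ, ‖z - c₀‖ ≤ ρ → h z ≠ 0 := by
    intro z hz hz0
    by_cases hzv : z = v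
    · exact hhv (by rw [← hzv]; exact hz0)
    by_cases hzc : z = c
    · exact hhc (by rw [← hzc]; exact hz0)
    have hFz : F z = 0 := by rw [hfac z, hz0, mul_zero]
    have := hiso z hFz hzv hzc
    linarith
  have hdv : v - c₀ = d := by rw [hc₀, hd]; ring
  have hdc' : c - c₀ = -d := by rw [hc₀, hd]; ring
  refine ⟨{v, c}, fun _ => 1, K, h, c₀, ρ, hρ0, hρim, hcol, ?_, hhd, ?_, hh0, ?_, ?_⟩
  · intro u hu
    rw [Finset.mem_insert, Finset.mem_singleton] at hu
    rcases hu with rfl | rfl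
    · rw [hdv]; exact hρd.le
    · rw [hdc', norm_neg]; exact hρd.le
  · intro z
    rw [nearPoly_pair_eval hvc]; exact hfac z
  · -- the model zero inside: Vieta
    obtain ⟨w, hw, hroot⟩ := exists_model_root K d hρd
    refine ⟨c₀ + w, by simpa using hw, ?_⟩
    rw [tiltModel_pair_eval hvc]
    have e : (c₀ + w - v) + (c₀ + w - c) + K * ((c₀ + w - v) * (c₀ + w - c)) = 2 * w + K * (w * w - d * d) := by
      rw [hc₀, hd]; ring
    rw [e, hroot]
  · intro z hz
    have hzv : h z ≠ 0 := hh0 z hz.le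
    have hhz : 0 < ‖h z‖ := norm_pos_iff.2 hzv
    have hdef : iteratedDeriv (j + 1) f z - (tiltModel {v, c} (fun _ => 1) K).eval z * h z =
        (nearPoly {v, c} (fun _ => 1)).eval z * (deriv h z - K * h z) := by
      rw [iteratedDeriv_succ]
      exact deriv_sub_model_eq K hhd (fun w => by rw [nearPoly_pair_eval hvc]; exact hfac w) z
    rw [hdef, norm_mul, norm_mul, nearPoly_pair_eval hvc, tiltModel_pair_eval hvc]
    have hsplit : ‖deriv h z - K * h z‖ = ‖h z‖ * ‖deriv h z / h z - K‖ := by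
      rw [← norm_mul]; congr 1; field_simp
    have hv' := hvar z hz
    rw [hsplit]
    calc ‖(z - v) * (z - c)‖ * (‖h z‖ * ‖deriv h z / h z - K‖)
        = (‖(z - v) * (z - c)‖ * ‖deriv h z / h z - K‖) * ‖h z‖ := by ring
      _ < ‖(z - v) + (z - c) + K * ((z - v) * (z - c))‖ * ‖h z‖ := mul_lt_mul_of_pos_right hv' hhz

/-- **ISOLATED-PAIR SUCCESSOR** (frame corollary): the two-body U door yields a level-`(j+1)` band state (`succ_of_clusterNumbersU`). -/
theorem succ_of_isolatedPair {η : ℝ} {f : ℂ → ℂ} {x₀ s hmax R Hs : ℝ} {B j : ℕ} {v c : ℂ}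
    (hE : EngineHyps5 2 η f x₀ s hmax R Hs B) (hst : StTrkDQ η f x₀ s hmax R Hs B j v) (hvc : v ≠ c)
    (hc : iteratedDeriv j f c = 0) (hv1 : iteratedDeriv (j + 1) f v ≠ 0) (hc1 : iteratedDeriv (j + 1) f c ≠ 0)
    {ρ : ℝ} (hρd : ‖(v - c) / 2‖ < ρ) (hρim : ρ ≤ ((v + c) / 2).im) (hcol : |((v + c) / 2).re - x₀| + ρ ≤ R / 2)
    (hiso : ∀ z : ℂ, iteratedDeriv j f z = 0 → z ≠ v → z ≠ c → ρ < ‖z - (v + c) / 2‖)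
    (K : ℂ)
    (hvar : ∀ z : ℂ, ‖z - (v + c) / 2‖ = ρ →
      ‖(z - v) * (z - c)‖ *
          ‖deriv (dslope (dslope (iteratedDeriv j f) v) c) z / dslope (dslope (iteratedDeriv j f) v) c z - K‖ <
        ‖(z - v) + (z - c) + K * ((z - v) * (z - c))‖) :
    ∃ u : ℂ, StTrkDQ η f x₀ s hmax R Hs B (j + 1) u :=
  succ_of_clusterNumbersU hE hst (clusterNumbersU_of_isolatedPair hE.1 hvc hst.2.1 hc hv1 hc1 hρd hρim hcol hiso K hvar)

end

end RhW08.Lens1TwoBody
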